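import Mathlib
import Summits.PneNP.PneNP.Theorems.SolvableImpliesStableSection.Negative.OriginValidCount

/-!
# Crux `SolvableImpliesStableSection` (stmt-PneNP-2463) — negative lemmas, part 2:
# the solvability hypothesis is load-bearing (no near-valid section in the unsatisfiable phase)

The crux (route OverlapGapAlgebra) is `∀ k ≥ 3, ∀ α η ν > 0, Solvable(k, α) → Concl(k, α, η, ν)`, where
`Concl` asks, for every `c > 0` and infinitely many `n`, for a section `g` of the solution bundle that
is `ν`-valid and `η n`-stable along the whole Bresler–Huang resampling path on at least an `e^{-cn}`
fraction of path tuples `Ψ : Fin (k+1) → Fin ⌊α n⌋₊ → Fin k → Fin n × Bool`.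

**Main results (def-free; the crux's conclusion is inlined verbatim).**

* `concl_false_of_rate` — for `k ≥ 1`, `0 ≤ ν ≤ 1/2`, `c > 0` and any density `α > 0` with
  `log 2 + c < α · ((1 - ν)·2^{-k} - h₂(ν))` (`h₂ = Real.binEntropy`), the conclusion of the crux at
  `(k, α, η, ν)` is FALSE for every `η`: eventually in `n`, for EVERY map `g`, already the paths on
  which `g` is `ν`-valid at the origin `Ψ 0` are fewer than `e^{-cn} · #paths`
  (`card_originValid_le` of part 1 and `log n = o(n)`).
* `solvableImpliesStableSection_false_without_solvable` — hence the crux with its hypothesis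
  `∃ f, IsPolyTime f ∧ …` deleted ("stable near-valid sections always exist") is false; witness
  `k = 3`, `α = 32`, `η = 1`, `ν = 1/128`, `c = 1` (`h₂(1/128) ≤ (7 log 2 + 1)/128`).

Reading for provers: with `Sketch.solvableImpliesStableSection_hyp_false_of_density_ge` (the
HYPOTHESIS is false for `α ≥ 2^k`), at large density the crux is vacuously true while its conclusion
is false — `Concl` cannot be established uniformly in the density; any proof must route the density
through the solvability hypothesis.  (Standing disprover, cycle 1; work file
`Cruxes/SolvableImpliesStableSection/Disproof.lean`.)
-/

set_option linter.dupNamespace false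

namespace Summit.PneNP.PneNP.Cruxes.SolvableImpliesStableSection.Negative

open Finset
open Summit.PneNP.PneNP.Cruxes.NoStableSection.DartGame (violCount)

section UnsatPhase

variable {k m n : ℕ}

/-- On the crux's path event, `g` is `ν`-valid at the origin `Ψ 0` (splice point `(0, 0)`; `k ≥ 1`). -/
theorem violCount_origin_le (hk : 1 ≤ k) {η ν : ℝ}
    {g : (Fin m → Fin k → Fin n × Bool) → (Fin n → Bool)}
    {Ψ : Fin (k + 1) → Fin m → Fin k → Fin n × Bool}
    (h : let P : Fin k → ℕ → Fin m → Fin k → Fin n × Bool :=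
        fun r q a b => if (a : ℕ) * k + b < q then Ψ r.succ a b else Ψ r.castSucc a b
      (∀ r : Fin k, ∀ q ≤ m * k, ((Finset.univ.filter fun i : Fin m =>
        ∀ j, g (P r q) (P r q i j).1 ≠ (P r q i j).2).card : ℝ) ≤ ν * m) ∧
      ∀ r : Fin k, ∀ q < m * k, (hammingDist (g (P r q)) (g (P r (q + 1))) : ℝ) ≤ η * n) :
    (violCount (g (Ψ 0)) (Ψ 0) : ℝ) ≤ ν * m := by
  obtain ⟨hval, -⟩ := h
  have h0 := hval ⟨0, hk⟩ 0 (Nat.zero_le _)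
  have hc : (⟨0, hk⟩ : Fin k).castSucc = (0 : Fin (k + 1)) := Fin.ext (by simp)
  have e : (fun (a : Fin m) (b : Fin k) => if (a : ℕ) * k + b < 0 then Ψ (⟨0, hk⟩ : Fin k).succ a b
      else Ψ (⟨0, hk⟩ : Fin k).castSucc a b) = Ψ 0 := by
    funext a b
    simp [hc]
  beta_reduce at h0
  rw [e] at h0
  exact h0

/-- For `n ≥ 1` the path space is nonempty, so its cardinality is positive. -/
theorem card_paths_pos (k m : ℕ) {n : ℕ} (hn : 1 ≤ n) :
    (0 : ℝ) < Fintype.card (Fin (k + 1) → Fin m → Fin k → Fin n × Bool) := by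
  haveI : Nonempty (Fin n × Bool) := ⟨(⟨0, hn⟩, false)⟩
  exact_mod_cast Fintype.card_pos

/-- `log x = o(x)` made effective along the naturals: for `δ > 0`, eventually `log n ≤ δ n`. -/
theorem eventually_log_le_mul {δ : ℝ} (hδ : 0 < δ) :
    ∀ᶠ n : ℕ in Filter.atTop, Real.log n ≤ δ * n := by
  have h := Real.isLittleO_log_id_atTop.bound hδ
  filter_upwards [tendsto_natCast_atTop_atTop.eventually h] with n hn
  have hn' : |Real.log n| ≤ δ * |(n : ℝ)| := by simpa only [Real.norm_eq_abs, id] using hn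
  have h2 : |(n : ℝ)| = n := abs_of_nonneg (Nat.cast_nonneg n)
  rw [h2] at hn'
  exact (le_abs_self _).trans hn'

/-- **Analytic comparison.** Under the rate condition `log 2 + c < α ((1-ν) 2^{-k} - h₂(ν))`, the
first-moment bound is eventually below `e^{-cn}`. -/
theorem eventually_firstMoment_lt {α ν c : ℝ} (hα : 0 < α) (hν0 : 0 ≤ ν) (hν2 : ν ≤ 2⁻¹)
    (hc : 0 < c)
    (hrate : Real.log 2 + c < α * ((1 - ν) * (1 / 2) ^ k - Real.binEntropy ν)) :
    ∀ᶠ n : ℕ in Filter.atTop,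
      (2 : ℝ) ^ n * ((⌊ν * ⌊α * n⌋₊⌋₊ + 1) * Real.exp (⌊α * n⌋₊ * Real.binEntropy ν)) *
        Real.exp (-((1 / 2 : ℝ) ^ k * ((1 - ν) * ⌊α * n⌋₊))) < Real.exp (-(c * n)) := by
  set R : ℝ := (1 - ν) * (1 / 2) ^ k - Real.binEntropy ν with hR
  set γ : ℝ := α * R - Real.log 2 - c with hγ
  have hγpos : 0 < γ := by rw [hγ]; linarith
  have hlog2 : 0 < Real.log 2 := Real.log_pos one_lt_two
  have hRpos : 0 < R := by
    have hc' : Real.log 2 + c < α * R := hrate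
    by_contra hR0
    have hR0' : R ≤ 0 := le_of_not_gt hR0
    have : α * R ≤ 0 := mul_nonpos_of_nonneg_of_nonpos hα.le hR0'
    nlinarith
  filter_upwards [eventually_log_le_mul (show 0 < γ / 4 by positivity),
    Filter.eventually_ge_atTop (⌈(Real.log (α + 1) + R) * (4 / γ)⌉₊ + 1)] with n hlog hn
  have hn1 : (1 : ℝ) ≤ n := by exact_mod_cast le_trans (Nat.le_add_left 1 _) hn
  have hnpos : (0 : ℝ) < n := by linarith
  -- the number of clauses `M = ⌊α n⌋₊` satisfies `α n - 1 < M ≤ α n`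
  set M : ℕ := ⌊α * (n : ℝ)⌋₊ with hM
  have hMle : (M : ℝ) ≤ α * n := Nat.floor_le (by positivity)
  have hMgt : α * n - 1 < M := by
    have := Nat.lt_floor_add_one (α * (n : ℝ))
    linarith
  -- `J + 1 ≤ (α + 1) n`
  have hJle : (⌊ν * (M : ℝ)⌋₊ : ℝ) + 1 ≤ (α + 1) * n := by
    have h1 : (⌊ν * (M : ℝ)⌋₊ : ℝ) ≤ ν * M := Nat.floor_le (by positivity)
    have h2 : ν * (M : ℝ) ≤ M := by nlinarith [Nat.cast_nonneg (α := ℝ) M]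
    nlinarith
  have hαn : 0 < (α + 1) * n := by positivity
  -- `log ((α+1) n) + R ≤ (γ/2) n` for `n` large
  have hconst : Real.log (α + 1) + R ≤ γ / 4 * n := by
    have h1 : ((⌈(Real.log (α + 1) + R) * (4 / γ)⌉₊ : ℕ) : ℝ) + 1 ≤ n := by exact_mod_cast hn
    have h2 : (Real.log (α + 1) + R) * (4 / γ) ≤ ⌈(Real.log (α + 1) + R) * (4 / γ)⌉₊ := Nat.le_ceil _
    have h3 : (Real.log (α + 1) + R) * (4 / γ) ≤ n := by linarith
    have := (mul_le_mul_of_nonneg_right h3 (show 0 ≤ γ / 4 by positivity))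
    have h4 : (Real.log (α + 1) + R) * (4 / γ) * (γ / 4) = Real.log (α + 1) + R := by
      field_simp
    linarith
  -- everything as a single exponential
  have h2n : (2 : ℝ) ^ n = Real.exp (n * Real.log 2) := by
    rw [Real.exp_nat_mul, Real.exp_log two_pos]
  have hJexp : (⌊ν * (M : ℝ)⌋₊ : ℝ) + 1 ≤ Real.exp (Real.log (α + 1) + Real.log n) := by
    rw [Real.exp_add, Real.exp_log (by positivity), Real.exp_log hnpos]
    exact hJle
  have hJ0 : (0 : ℝ) ≤ (⌊ν * (M : ℝ)⌋₊ : ℝ) + 1 := by positivity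
  calc (2 : ℝ) ^ n * (((⌊ν * (M : ℝ)⌋₊ : ℝ) + 1) * Real.exp (M * Real.binEntropy ν)) *
        Real.exp (-((1 / 2 : ℝ) ^ k * ((1 - ν) * M)))
      ≤ Real.exp (n * Real.log 2) * (Real.exp (Real.log (α + 1) + Real.log n) *
          Real.exp (M * Real.binEntropy ν)) * Real.exp (-((1 / 2 : ℝ) ^ k * ((1 - ν) * M))) := by
        rw [h2n]
        gcongr
    _ = Real.exp (n * Real.log 2 + (Real.log (α + 1) + Real.log n) - M * R) := by
        rw [← Real.exp_add, ← Real.exp_add, ← Real.exp_add, hR]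
        ring_nf
    _ < Real.exp (-(c * n)) := Real.exp_lt_exp.2 (by nlinarith)

/-- **The crux's conclusion is false in the unsatisfiable phase.** For `k ≥ 1`, `0 ≤ ν ≤ 1/2`, `c > 0`
and a density with `log 2 + c < α · ((1 - ν) 2^{-k} - h₂(ν))`, the consequent of
`SolvableImpliesStableSection` at `(k, α, η, ν)` (inlined verbatim below) fails for every `η`:
eventually, for every section `g`, even the paths on which `g` is merely `ν`-valid at the origin are
fewer than `e^{-cn} · #paths`. -/
theorem concl_false_of_rate (hk : 1 ≤ k) {α ν c : ℝ} (hα : 0 < α) (hν0 : 0 ≤ ν)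
    (hν2 : ν ≤ 2⁻¹) (hc : 0 < c)
    (hrate : Real.log 2 + c < α * ((1 - ν) * (1 / 2) ^ k - Real.binEntropy ν)) (η : ℝ) :
    ¬ (∀ c : ℝ, 0 < c → ∃ᶠ n : ℕ in Filter.atTop, ∀ m : ℕ, m = ⌊α * n⌋₊ →
      ∃ g : (Fin m → Fin k → Fin n × Bool) → (Fin n → Bool),
        Real.exp (-(c * n)) * Fintype.card (Fin (k + 1) → Fin m → Fin k → Fin n × Bool) ≤
        ((Finset.univ.filter fun Ψ : Fin (k + 1) → Fin m → Fin k → Fin n × Bool =>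
          let P : Fin k → ℕ → Fin m → Fin k → Fin n × Bool :=
            fun r q a b => if (a : ℕ) * k + b < q then Ψ r.succ a b else Ψ r.castSucc a b
          (∀ r : Fin k, ∀ q ≤ m * k, ((Finset.univ.filter fun i : Fin m =>
            ∀ j, g (P r q) (P r q i j).1 ≠ (P r q i j).2).card : ℝ) ≤ ν * m) ∧
          ∀ r : Fin k, ∀ q < m * k,
            (hammingDist (g (P r q)) (g (P r (q + 1))) : ℝ) ≤ η * n).card : ℝ)) := by
  intro hC
  obtain ⟨n, hn, hlt, hn1⟩ := ((hC c hc).and_eventually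
    ((eventually_firstMoment_lt (k := k) hα hν0 hν2 hc hrate).and (Filter.eventually_ge_atTop 1))).exists
  obtain ⟨g, hg⟩ := hn _ rfl
  have hcard := card_paths_pos k ⌊α * (n : ℝ)⌋₊ hn1
  have hle := card_originValid_le (k := k) (m := ⌊α * (n : ℝ)⌋₊) (n := n) hν0 hν2 g
  refine absurd hg (not_le.2 (lt_of_le_of_lt (le_trans ?_ hle) (mul_lt_mul_of_pos_right hlt hcard)))
  exact_mod_cast Finset.card_le_card fun Ψ hΨ => by
    simp only [Finset.mem_filter, Finset.mem_univ, true_and] at hΨ ⊢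
    exact violCount_origin_le hk hΨ

end UnsatPhase

/-- Numerical entropy bound at the witness: `h₂(1/128) ≤ (7 log 2 + 1)/128`. -/
theorem binEntropy_inv128_le : Real.binEntropy (1 / 128) ≤ (7 * Real.log 2 + 1) / 128 := by
  have h128 : ((1 : ℝ) / 128)⁻¹ = 2 ^ 7 := by norm_num
  have h1 : (1 - (1 : ℝ) / 128)⁻¹ = 128 / 127 := by norm_num
  have hlog : Real.log ((128 : ℝ) / 127) ≤ 128 / 127 - 1 := Real.log_le_sub_one_of_pos (by norm_num)
  simp only [Real.binEntropy, h128, h1, Real.log_pow]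
  push_cast
  nlinarith [hlog]

/-- **`SolvableImpliesStableSection` is false without its solvability hypothesis**
(`SolvableImpliesStableSection_false_without_Solvable`): the crux with the antecedent
`∃ f, IsPolyTime f ∧ …` deleted — "for every `k ≥ 3` and all `α, η, ν > 0`, stable near-valid sections
exist with probability `e^{-o(n)}`" — is refuted at `k = 3`, `α = 32`, `η = 1`, `ν = 1/128`, rate
`c = 1` (`h₂(1/128) ≤ (7 log 2 + 1)/128` and `log 2 + 1 < 32 · ((127/128)/8 - (7 log 2 + 1)/128)`).
So the solvability hypothesis is load-bearing: the density can enter a proof of the crux only through it. -/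
theorem solvableImpliesStableSection_false_without_solvable :
    ¬ (∀ k : ℕ, 3 ≤ k → ∀ α η ν : ℝ, 0 < α → 0 < η → 0 < ν →
      ∀ c : ℝ, 0 < c → ∃ᶠ n : ℕ in Filter.atTop, ∀ m : ℕ, m = ⌊α * n⌋₊ →
        ∃ g : (Fin m → Fin k → Fin n × Bool) → (Fin n → Bool),
          Real.exp (-(c * n)) * Fintype.card (Fin (k + 1) → Fin m → Fin k → Fin n × Bool) ≤
          ((Finset.univ.filter fun Ψ : Fin (k + 1) → Fin m → Fin k → Fin n × Bool =>
            let P : Fin k → ℕ → Fin m → Fin k → Fin n × Bool :=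
              fun r q a b => if (a : ℕ) * k + b < q then Ψ r.succ a b else Ψ r.castSucc a b
            (∀ r : Fin k, ∀ q ≤ m * k, ((Finset.univ.filter fun i : Fin m =>
              ∀ j, g (P r q) (P r q i j).1 ≠ (P r q i j).2).card : ℝ) ≤ ν * m) ∧
            ∀ r : Fin k, ∀ q < m * k,
              (hammingDist (g (P r q)) (g (P r (q + 1))) : ℝ) ≤ η * n).card : ℝ)) := by
  intro h
  refine concl_false_of_rate (k := 3) (by norm_num) (by norm_num) (by norm_num) (by norm_num) one_pos
    ?_ 1 (h 3 (by norm_num) 32 1 (1 / 128) (by norm_num) one_pos (by norm_num))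
  have h2 := Real.log_two_lt_d9
  have hH := binEntropy_inv128_le
  nlinarith

end Summit.PneNP.PneNP.Cruxes.SolvableImpliesStableSection.Negative
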